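import Literature.Probability.RandomPlanarGeometry.SLESixHullLocalityNbhdProved
import Literature.Probability.RandomPlanarGeometry.SLESixHullLocalityReductionNbhd
import HarnessLib

/-!
# Discharge of the named fact `locality_six_bounded`

Topic `Literature/Probability/RandomPlanarGeometry`; proofs-only file (no definitions, no new
named facts). The named fact
`Literature.Probability.RandomPlanarGeometry.IsSLELaw.locality_six_bounded`
(`SLESixHullLocalityFact.lean:69`)
is closed by ONE TERM from results already in the tree: the accepted reduction
`Literature.Probability.RandomPlanarGeometry.IsSLELaw.locality_six_bounded_of_hull_nbhd`
(`SLESixHullLocalityReductionNbhd.lean:228`)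
applied to the accepted unconditional discharges `sle_six_hull_locality_nbhd_holds` of its
hypotheses.
Found by the librarian's forward-chaining census (sweep g29, 2026-08-16): the reduction and the
last of its inputs landed in
different units, so nobody had written the closing line.
-/

namespace Literature.Probability.RandomPlanarGeometry.IsSLELaw

/-- **`locality_six_bounded` holds**: the reduction `locality_six_bounded_of_hull_nbhd` applied to
`sle_six_hull_locality_nbhd_holds`. [folklore] -/
theorem locality_six_bounded_holds : locality_six_bounded :=
  _root_.Literature.Probability.RandomPlanarGeometry.IsSLELaw.locality_six_bounded_of_hull_nbhd
    _root_.Literature.Probability.RandomPlanarGeometry.sle_six_hull_locality_nbhd_holds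

end Literature.Probability.RandomPlanarGeometry.IsSLELaw
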